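/-
Copyright (c) 2026 the pub-hodgecm-mathlib formalisation cell (harness21).  Prover seat hodgecm-mathlib-F0P3-p01 (g31), «(D-RAM) FOUR-FRAME» road of crux H413, line LH4,
unit U3_Laws, κ-STAGE B brick κG₂ «G₁-κ» (dealer LH4-plan (g11) WORD #52 (a); letter LH4-p09 (g3) `LETTER-kappaBG-tv2.v1` §1 (ρ = 0), κ owner LH4-p05 (g3)).
FILE κG₂-A2₀ (part 2) — THE κ-COUNT OF A ROOT-GLUED TYPE-2 LATTICE AS A SUM OVER THE FIXED CLASSES OF VALUATION `2t` MODULO `𝔭^{1+2t}`.  2026-09-04.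
-/
import Summits.HodgeConjecture.HodgeConjecture.Theorems.F0P3cDyRamDiagonalKappaGluedClassTwoZero    -- κG₂-A2₀ part 1 (this seat): S_F, windows, section signs; brings ★ G2-C1∕C2, ★ κG₂-A2 part 1
import HarnessLib

/-!
# Crux `H413`, κ-STAGE B brick κG₂, FILE A2₀ (part 2): `kappaCount σ ϖ 2 i (latt W(y″, ζ)) = Σ_{g ∈ S} [window_i]·χ_i` on the root-glued type-2 stratum (ρ = 0)

Cell `hodgecm-mathlib` (D-0151), FLOOR 0, crux item H413 = `stmt-HodgeConjecture-24833`; lane `--supports stmt-HodgeConjecture-24833 --as helper` (count-neutral).  THEOREMS ONLY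
(no `def`, no instance, no notation, no `sorry`).  Root-glued frame `W(y″, ζ) = (1 0 0; 0 1 0; y″ ζ ϖ^{1+2t})`, `|ζ| = 1`, `|y″| = |ϖ|^{2t}`, `t ≥ 1`.  LH4-p08 (g3)'s ★ G2-C1: the
polarisation cosets of `latt W` are the fibres of the σ-fixed invariant `r(D) = (D₀ + σy″·D₂·y″)∕D₂`, `|r| = |ϖ|^{2t}`, modulo `𝔭^{2t+1}` (★ `exists_stabiliser_iff_v_ratio_sub_le_zero`,
★ `structure_of_polarisation_zero`); the explicit family (★ `isVertexLattice_two_latt_glued_zero_explicit`) at `α_g = −(g·Nζ·P)⁻¹` has `r = −Ny″∕g`, and `g ↦ −Ny″∕g` preserves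
`𝔭^{2t+1}`-closeness on valuation `2t`; so for any complete irredundant finite system `S` of the fixed `g`, `|g| = |ϖ|^{2t}`, modulo `𝔭^{1+2t}` the cosets are `(g ↦ D(α_g)·S_F)″S`
injectively and `kappaCount = Σ_{g ∈ S} cosetKappa(D(α_g)·S_F) = Σ_{g ∈ S} [window_i]·χ_i(g)` (★ Fκ2 dichotomy + part 1).
HEAD **`kappaCount_two_latt_glued_zero_rep`** — the value is independent of `(y″, ζ)`: the κ-count is CONSTANT on the root-glued stratum, so the ρ = 0 socket needs no orbit argument.
HONEST LABEL.  Count-neutral (`--supports`); the κ-laws stay PROVER TARGETS; `HC_CM` is proved only modulo the 7 printed citations (2 remaining named inputs: hLiu418 =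
`stmt-HodgeConjecture-24832`, h413 = `stmt-HodgeConjecture-24833`) until rung 0 closes.

## References
* [Kottwitz1986BaseChangeUnits] R. E. Kottwitz, *Base change for unit elements of Hecke algebras*, Compositio Math. 60 (1986), §1 pp. 240–241 (fixed-lattice counts via torus orbits).
* [LanglandsShelstad1987] R. P. Langlands, D. Shelstad, *On the definition of transfer factors*, Math. Ann. 278 (1987), §3 (the κ-signs).
* [Serre1979] J.-P. Serre, *Local Fields*, GTM 67 (1979), Ch. V §3 Prop. 5, Cor. 3; Ch. XV §2.
-/

set_option autoImplicit false

noncomputable section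

namespace Summit.HodgeConjecture.HodgeConjecture.Cruxes.H413.F0P3cDyRamDiagonalKappaGluedClassTwoZeroCount

open Matrix
open Literature.NumberTheory.Automorphic Literature.NumberTheory.Automorphic.HermitianLattice Literature.NumberTheory.Automorphic.UnitaryGroup
open Literature.NumberTheory.Automorphic.UnitaryLatticeTree Literature.NumberTheory.Automorphic.UnitaryThreeFourFrame
open Literature.NumberTheory.LocalFields.WildQuadraticDatum
open Summit.HodgeConjecture.HodgeConjecture.Cruxes.H413.F0P3cDyRamDiagonalTorusDefs
open Summit.HodgeConjecture.HodgeConjecture.Cruxes.H413.F0P3cDyRamDiagonalStrataDefs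
open Summit.HodgeConjecture.HodgeConjecture.Cruxes.H413.F0P3cDyRamDiagonalKappaCountDefs
open Summit.HodgeConjecture.HodgeConjecture.Cruxes.H413.F0P3cDyRamDiagonalKappaCountEval hiding normSign_mul_of_dichotomy
open Summit.HodgeConjecture.HodgeConjecture.Cruxes.H413.F0P3cDyRamDiagonalKappaGluedClassTwoZero
open Summit.HodgeConjecture.HodgeConjecture.Cruxes.H413.F0P3cDyRamDiagonalGluedStabiliserIndex (ne_zero_and_v_lt_one_of_v_eq_exp)
open Summit.HodgeConjecture.HodgeConjecture.Cruxes.H413.F0P3cDyRamDiagonalGluedZeroPolarisationClassesTypeTwo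
  (isVertexLattice_two_latt_glued_zero_explicit structure_of_polarisation_zero exists_stabiliser_iff_v_ratio_sub_le_zero)
open Summit.HodgeConjecture.HodgeConjecture.Cruxes.H413.F0P3cDyRamDiagonalGluedPolarisationCountTypeTwo (mem_coset_self coset_eq_of_exists)
open scoped Valued WithZero Matrix MatrixGroups

variable {K : Type} [Field K] [Valued K ℤᵐ⁰] [CompleteSpace K] [Finite 𝓀[K]] {σ : K →+* K} {ϖ : K} {d t₂ : ℕ}

open Classical in
/-- **THE κ-COUNT OF A ROOT-GLUED TYPE-2 LATTICE `latt W(y″, ζ)`, COSET BY COSET** (ramified quadratic datum with `|2| < 1` on a complete `K` with finite residue field; `t ≥ 1`;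
`|ζ| = 1`, `|y″| = |ϖ|^{2t}`; `S` a finite complete irredundant system, modulo `𝔭^{1+2t}`, of the σ-fixed `g` with `|g| = |ϖ|^{2t}`; `ω = normSign σ`):
`kappaCount σ ϖ 2 i (latt W) = Σ_{g ∈ S} (![ [2d ≤ 2t+2]·ω(−1)ω(1+g), [2d ≤ 2]·ω(−1)ω(g)ω(1+g), [2d ≤ 2]·ω(g) ] i)`.
[cite: Kottwitz1986BaseChangeUnits, §1 pp. 240–241] [cite: LanglandsShelstad1987, §3] [cite: Serre1979, Ch. V §3 Prop. 5, Cor. 3] -/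
theorem kappaCount_two_latt_glued_zero_rep (hD : IsRamifiedQuadraticDatum σ ϖ d t₂) (h2 : Valued.v (2 : K) < 1) {t : ℕ} (ht : 1 ≤ t)
    {ζ y'' : K} (hζ : Valued.v ζ = 1) (hy'' : Valued.v y'' = Valued.v ϖ ^ (2 * t)) (V : GL (Fin 3) K)
    (hV : (V : Matrix (Fin 3) (Fin 3) K) = !![1, 0, 0; 0, 1, 0; y'', ζ, ϖ ^ (1 + 2 * t)])
    (S : Finset K) (hS1 : ∀ g ∈ S, σ g = g ∧ Valued.v g = Valued.v ϖ ^ (2 * t))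
    (hS2 : ∀ f : K, σ f = f → Valued.v f = Valued.v ϖ ^ (2 * t) → ∃ g ∈ S, Valued.v (f - g) ≤ Valued.v ϖ ^ (1 + 2 * t))
    (hS3 : ∀ g ∈ S, ∀ g' ∈ S, Valued.v (g - g') ≤ Valued.v ϖ ^ (1 + 2 * t) → g = g') (i : Fin 3) :
    kappaCount σ ϖ 2 i (latt (V : Matrix (Fin 3) (Fin 3) K)) =
      ∑ g ∈ S, (![if 2 * d ≤ 2 * t + 2 then normSign σ (-1) * normSign σ (1 + g) else 0,
         if 2 * d ≤ 2 then normSign σ (-1) * normSign σ g * normSign σ (1 + g) else 0,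
         if 2 * d ≤ 2 then normSign σ g else 0] : Fin 3 → ℤ) i := by
  obtain ⟨hσ, hvσ, hϖ, hfix, hdd, hd1, -⟩ := id hD
  obtain ⟨hϖ0, hϖ1⟩ := ne_zero_and_v_lt_one_of_v_eq_exp hϖ
  have hvϖ : 0 < Valued.v ϖ := (Valuation.pos_iff _).2 hϖ0
  obtain ⟨c, hσc, hcn, hdich⟩ := exists_nonnorm_dichotomy hD
  set M := latt (V : Matrix (Fin 3) (Fin 3) K) with hM
  have hσϖ0 : σ ϖ ≠ 0 := fun h => hϖ0 (by rw [← hσ ϖ, h, map_zero])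
  have hζ0 : ζ ≠ 0 := fun h => by rw [h, map_zero] at hζ; exact zero_ne_one hζ
  have hy0 : y'' ≠ 0 := fun h => by rw [h, map_zero] at hy''; exact (pow_ne_zero _ hvϖ.ne') hy''.symm
  have hpt : Valued.v ϖ ^ (2 * t) ≠ 0 := pow_ne_zero _ hvϖ.ne'
  -- letters: `P`, `Nζ`, `Ny″`
  set P : K := ((ϖ * σ ϖ) ^ t)⁻¹ with hP
  have hPdef : P = ((ϖ * σ ϖ) ^ (2 * t / 2))⁻¹ := by rw [show 2 * t / 2 = t by omega]
  have hvP : Valued.v P = (Valued.v ϖ ^ (2 * t))⁻¹ := by rw [hP, map_inv₀, map_pow, map_mul, hvσ, ← pow_two, ← pow_mul, mul_comm]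
  have hP0 : P ≠ 0 := by rw [hP]; exact inv_ne_zero (pow_ne_zero _ (mul_ne_zero hϖ0 hσϖ0))
  have hσP : σ P = P := by rw [hP, map_inv₀, map_pow, map_mul, hσ, mul_comm (σ ϖ)]
  have hvNζ : Valued.v (ζ * σ ζ) = 1 := by rw [map_mul, hvσ, hζ, mul_one]
  have hNζ0 : ζ * σ ζ ≠ 0 := fun h => by rw [h, map_zero] at hvNζ; exact zero_ne_one hvNζ
  have hσNζ : σ (ζ * σ ζ) = ζ * σ ζ := by rw [map_mul, hσ, mul_comm]
  have hvNy : Valued.v (σ y'' * y'') = Valued.v ϖ ^ (2 * t) * Valued.v ϖ ^ (2 * t) := by rw [map_mul, hvσ, hy'']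
  have hσy0 : σ y'' ≠ 0 := fun h => hy0 (by rw [← hσ y'', h, map_zero])
  have hσζ0 : σ ζ ≠ 0 := fun h => hζ0 (by rw [← hσ ζ, h, map_zero])
  have hNy0 : σ y'' * y'' ≠ 0 := mul_ne_zero hσy0 hy0
  have hσNy : σ (σ y'' * y'') = σ y'' * y'' := by rw [map_mul, hσ, mul_comm]
  -- the valuation-`2t` fixed elements: non-zero, `1 + g ≠ 0`
  have hg0 : ∀ g : K, Valued.v g = Valued.v ϖ ^ (2 * t) → g ≠ 0 := fun g hg h => by rw [h, map_zero] at hg; exact hpt hg.symm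
  have h1g : ∀ g : K, Valued.v g = Valued.v ϖ ^ (2 * t) → 1 + g ≠ 0 := fun g hg h => by
    have hv1 : Valued.v (1 + g) = 1 := Valued.v.map_one_add_of_lt (by rw [hg]; exact pow_lt_one₀ zero_le hϖ1 (by omega))
    rw [h, map_zero] at hv1; exact zero_ne_one hv1
  -- the section `g ↦ D(α_g)`, `α_g = −(g·Nζ·P)⁻¹`
  set α : K → K := fun g => -(g * (ζ * σ ζ) * P)⁻¹ with hαdef
  have hσα : ∀ g : K, σ g = g → σ (α g) = α g := fun g hg => by simp only [hαdef, map_neg, map_inv₀, map_mul, hg, hσNζ, hσP]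
  have hvα : ∀ g : K, Valued.v g = Valued.v ϖ ^ (2 * t) → Valued.v (α g) = 1 := fun g hg => by
    simp only [hαdef, Valuation.map_neg, map_inv₀, map_mul, hg, hvNζ, hvP, mul_one, mul_inv_cancel₀ hpt, inv_one]
  set Dsec : K → Fin 3 → K := fun g => ![σ y'' * y'' * P * (α g * (ζ * σ ζ) * P - 1), (α g)⁻¹ - P * (ζ * σ ζ), P] with hDsec
  have hsec : ∀ g : K, σ g = g → Valued.v g = Valued.v ϖ ^ (2 * t) →
      (∀ j, σ (Dsec g j) = Dsec g j ∧ Dsec g j ≠ 0) ∧ IsVertexLattice σ ϖ (Matrix.diagonal (Dsec g)) 2 M := fun g hg hvg =>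
    isVertexLattice_two_latt_glued_zero_explicit hσ hvσ hϖ0 hϖ1 (2 * t) (dvd_mul_right 2 t) (by omega) hζ hy'' V hV (hσα g hg) (hvα g hvg) hPdef rfl rfl
  -- the class invariant of the section: `r(D(α_g)) = −Ny″∕g`
  have hr : ∀ g : K, Valued.v g = Valued.v ϖ ^ (2 * t) → (Dsec g 0 + σ y'' * Dsec g 2 * y'') / Dsec g 2 = -(σ y'' * y'') / g := by
    intro g hg
    have hg0' := hg0 g hg
    simp only [hDsec, hαdef, Fin.isValue, Matrix.cons_val_zero, Matrix.cons_val_two, Matrix.tail_cons, Matrix.head_cons]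
    field_simp
    ring
  -- `g ↦ −Ny″∕g` preserves `𝔭^{2t+1}`-distances on valuation `2t`
  have hrdist : ∀ g g' : K, Valued.v g = Valued.v ϖ ^ (2 * t) → Valued.v g' = Valued.v ϖ ^ (2 * t) →
      Valued.v (-(σ y'' * y'') / g - -(σ y'' * y'') / g') = Valued.v (g - g') := by
    intro g g' hg hg'
    have hg0a := hg0 g hg
    have hg0b := hg0 g' hg'
    rw [show -(σ y'' * y'') / g - -(σ y'' * y'') / g' = (σ y'' * y'') * (g - g') / (g * g') by field_simp; ring]
    simp only [map_div₀, map_mul, hvσ, hy'', hg, hg']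
    rw [mul_comm, mul_div_assoc, div_self (mul_ne_zero hpt hpt), mul_one]
  set coset : (Fin 3 → K) → Set (Fin 3 → K) := fun D => {D' : Fin 3 → K | ∃ u ∈ fixedUnitStabilizer σ M, ∀ j, D' j = D j * ((u j : Kˣ) : K)} with hcoset
  -- relatedness of two sections ⟺ closeness of the parameters (★ G2-C1)
  have key : ∀ g g' : K, σ g = g → Valued.v g = Valued.v ϖ ^ (2 * t) → σ g' = g' → Valued.v g' = Valued.v ϖ ^ (2 * t) →
      ((∃ u ∈ fixedUnitStabilizer σ M, ∀ j, Dsec g' j = Dsec g j * ((u j : Kˣ) : K)) ↔ Valued.v (g - g') ≤ Valued.v ϖ ^ (1 + 2 * t)) := by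
    intro g g' hg hvg hg' hvg'
    obtain ⟨hDa, hva⟩ := hsec g hg hvg
    obtain ⟨hDb, hvb⟩ := hsec g' hg' hvg'
    rw [exists_stabiliser_iff_v_ratio_sub_le_zero hvσ hfix hϖ (2 * t) (dvd_mul_right 2 t) (by omega) hζ hy'' V hV hDa hva hDb hvb, hr g hvg, hr g' hvg',
      hrdist g g' hvg hvg', show 2 * t + 1 = 1 + 2 * t by ring]
  -- `polarisationCosets` is the image of `S`
  have himage : polarisationCosets σ ϖ 2 M = ↑(S.image fun g => coset (Dsec g)) := by
    ext C
    rw [Finset.coe_image, Set.mem_image, mem_polarisationCosets_iff]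
    constructor
    · rintro ⟨D, ⟨hDfix, hvert⟩, rfl⟩
      obtain ⟨hvD2, ⟨hvnum, -, -⟩, -⟩ := structure_of_polarisation_zero hvσ hfix hϖ (2 * t) (dvd_mul_right 2 t) (by omega) hζ hy'' V hV hDfix hvert
      set r : K := (D 0 + σ y'' * D 2 * y'') / D 2 with hrdef
      have hD20 : D 2 ≠ 0 := (hDfix 2).2
      have hσr : σ r = r := by
        simp only [hrdef, map_div₀, map_add, map_mul, hσ, (hDfix 0).1, (hDfix 2).1]; ring
      have hvr : Valued.v r = Valued.v ϖ ^ (2 * t) := by rw [hrdef, map_div₀, hvnum, hvD2, one_div, inv_inv]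
      have hr0 : r ≠ 0 := hg0 r hvr
      -- `f := −Ny″∕r` is fixed of valuation `2t`; take its representative
      set f : K := -(σ y'' * y'') / r with hfdef
      have hσf : σ f = f := by rw [hfdef, map_div₀, map_neg, hσNy, hσr]
      have hvf : Valued.v f = Valued.v ϖ ^ (2 * t) := by
        rw [hfdef, map_div₀, Valuation.map_neg, hvNy, hvr, mul_div_assoc, div_self hpt, mul_one]
      obtain ⟨g, hgS, hfg⟩ := hS2 f hσf hvf
      refine ⟨g, Finset.mem_coe.2 hgS, ?_⟩
      obtain ⟨hσg, hvg⟩ := hS1 g hgS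
      obtain ⟨hDg, hvertg⟩ := hsec g hσg hvg
      -- `r = −Ny″∕f`, so `r(D) − r(D(α_g)) = −Ny″∕f − (−Ny″∕g)` has valuation `|f − g| ≤ |ϖ|^{1+2t}`
      have hrf : r = -(σ y'' * y'') / f := by rw [hfdef]; field_simp
      have hrel : ∃ u ∈ fixedUnitStabilizer σ M, ∀ j, D j = Dsec g j * ((u j : Kˣ) : K) := by
        refine (exists_stabiliser_iff_v_ratio_sub_le_zero hvσ hfix hϖ (2 * t) (dvd_mul_right 2 t) (by omega) hζ hy'' V hV hDg hvertg hDfix hvert).2 ?_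
        rw [hr g hvg, ← hrdef, hrf, hrdist g f hvg hvf, Valuation.map_sub_swap, show 2 * t + 1 = 1 + 2 * t by ring]
        exact hfg
      exact (coset_eq_of_exists σ M hrel).symm
    · rintro ⟨g, hgS, rfl⟩
      have hgS' := Finset.mem_coe.1 hgS
      exact ⟨Dsec g, hsec g (hS1 g hgS').1 (hS1 g hgS').2, rfl⟩
  have hinj : Set.InjOn (fun g => coset (Dsec g)) ↑S := by
    intro g hg g' hg' h
    have hgS := Finset.mem_coe.1 hg
    have hg'S := Finset.mem_coe.1 hg'
    refine hS3 g hgS g' hg'S ((key g g' (hS1 g hgS).1 (hS1 g hgS).2 (hS1 g' hg'S).1 (hS1 g' hg'S).2).1 ?_)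
    have hmem : Dsec g' ∈ coset (Dsec g) := by simp only [h]; exact mem_coset_self σ M _
    exact hmem
  -- the κ-count as a sum over `S`
  rw [kappaCount, himage, finsum_mem_coe_finset, Finset.sum_image hinj]
  refine Finset.sum_congr rfl fun g hgS => ?_
  obtain ⟨hσg, hvg⟩ := hS1 g hgS
  obtain ⟨hDg, -⟩ := hsec g hσg hvg
  rw [hcoset, cosetKappa_coset_eq_of_dichotomy σ hσc hcn hdich i M hDg]
  have hχ : chiVec σ i (Dsec g) = (![normSign σ (-1) * normSign σ (1 + g), normSign σ (-1) * normSign σ g * normSign σ (1 + g), normSign σ g] : Fin 3 → ℤ) i := by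
    have h := chiVec_section_zero hD t hσg (hg0 g hvg) (h1g g hvg) hζ0 hy0 i
    rw [hDsec, hαdef, hP]
    exact h
  have hwin := forall_chiVec_eq_one_iff_window_zero hD h2 t hζ hy'' V hV i
  fin_cases i
  · simp only [Fin.zero_eta, Fin.isValue, Matrix.cons_val_zero] at hχ hwin ⊢
    by_cases hw : 2 * d ≤ 2 * t + 2
    · rw [if_pos (hwin.2 hw), if_pos hw, hχ]
    · rw [if_neg (fun h => hw (hwin.1 h)), if_neg hw]
  · simp only [Fin.mk_one, Fin.isValue, Matrix.cons_val_one, Matrix.cons_val_zero] at hχ hwin ⊢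
    by_cases hw : 2 * d ≤ 2
    · rw [if_pos (hwin.2 hw), if_pos hw, hχ]
    · rw [if_neg (fun h => hw (hwin.1 h)), if_neg hw]
  · simp only [Fin.reduceFinMk, Fin.isValue, Matrix.cons_val_two, Matrix.tail_cons, Matrix.head_cons] at hχ hwin ⊢
    by_cases hw : 2 * d ≤ 2
    · rw [if_pos (hwin.2 hw), if_pos hw, hχ]
    · rw [if_neg (fun h => hw (hwin.1 h)), if_neg hw]

end Summit.HodgeConjecture.HodgeConjecture.Cruxes.H413.F0P3cDyRamDiagonalKappaGluedClassTwoZeroCount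

end
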